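import Literature.NumberTheory.PAdicHodge.DeRhamSupersingularOfEtaHasse
import Literature.NumberTheory.PAdicHodge.AinfWeierstrassEtaHasseCongruence
import HarnessLib

/-!
# `V_pE` is de Rham at good SUPERSINGULAR reduction (`p ≥ 5`), modulo the η-Hasse invariant `B_p(W) ≢ 0`

Topic `Literature/NumberTheory/PAdicHodge`; namespace `Literature.NumberTheory.PAdicHodge`. THEOREMS ONLY (no definition, no named
fact, no instance, no `sorry`).

Capstone of the `p`-adic period road (Fontaine 1982 §5, Colmez 1992 §2) to Fontaine's theorem "`V_pE` is de Rham" for curves with a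
`ℤ`-model `W` having good supersingular reduction at a prime `p ≥ 5`, over any `p`-adic field `F` with any `ℚ_p`-algebra structure
(BSD route EdixhovenFibreFiveSeven, crux K★, hDR|ss): the η-Hasse congruence of `isDeRham_rationalTateRep_curveF_of_etaHasse`
(file `DeRhamSupersingularOfEtaHasse`) is COMPUTED in `AinfWeierstrassEtaHasseCongruence` — its low half holds unconditionally and its
top half is `p ∤ B_p(W)` with the **η-Hasse invariant `B_p(W) := [X^{p−1}] g_W`** (`g_W = formalQuasiPeriodIntegrand W`, the regular
part of `x(z)ω(z)/dz`; compare `A_p(W) ≡ [z^{p−1}](ω/dz)`). Hence: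

* `isDeRham_rationalTateRep_curveF_of_supersingular`: `p ≥ 5`, `p ∤ Δ_W`, `A_p(W mod p) = 0`, `p ∤ B_p(W)` ⟹
  `GaloisRep.IsDeRham (bdRPeriodRingData hp) (rationalTateRep (curveF F W) p)`;
* `isDeRham_restrictedRationalTateRep_of_supersingular`: the same for a curve over a subfield `K₀ ⊆ F` with base change `W ×_ℤ F`
  (the currency of the cite-only fact `isDeRham_restrictedRationalTateRep`).

What remains for this sector of hDR: the identity "`A_p = 0 ⇒ B_p ≢ 0 (mod p)`" for nonsingular `W mod p` (surjectivity of the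
Cartier operator `H¹_dR(E) → H⁰(E, Ω¹)`; checked symbolically at `p = 5, 7` on short Weierstrass forms: `(A₅, B₅) = (2a₄, −2a₆)`,
`(A₇, B₇) = (3a₆, −3a₄²)` up to units), `p ≤ 3`, and the ramified-coefficient version (R1) needed by K★'s additive cells. BSD is
not proved by any of this; `isDeRham_restrictedRationalTateRep` stays cite-only.

## References
* [Fontaine1982FormesDifferentielles] J.-M. Fontaine, Invent. Math. 65 (1982), §5.
* [Colmez1992PeriodesAbeliennes] P. Colmez, Math. Ann. 292 (1992), §2.
* [Katz1981CrystallineDieudonne] N. M. Katz (1981), §5.1.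
* [Tate1967] J. Tate, *p-divisible groups* (1967), §4.
-/

noncomputable section

namespace Literature.NumberTheory.PAdicHodge

open Literature Literature.NumberTheory.GaloisRepresentations Literature.NumberTheory.EllipticCurves WeierstrassCurve
open Literature.NumberTheory.GaloisRepresentations.IsNonarchimedeanLocalField Field ValuativeRel

variable {F : Type} [Field F] [ValuativeRel F] [TopologicalSpace F] [IsNonarchimedeanLocalField F] [CharZero F]
  {p : ℕ} [Fact p.Prime] [Fact (¬ IsUnit (p : integerC F))] [IsAdicComplete (Ideal.span {(p : integerC F)}) (integerC F)]
  (hp : valuation F p < 1) [Algebra ℚ_[p] F]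

/-- **`V_p(W ×_ℤ F)` is de Rham at a prime `p ≥ 5` of good supersingular reduction with `B_p(W) ≢ 0 (mod p)`**, for every
`p`-adic field `F`: `isDeRham_rationalTateRep_curveF_of_etaHasse` with the η-Hasse congruence supplied by
`AinfTop.prime_dvd_coeff_mulDefectInt_of_lt` (low part, unconditional) and
`AinfTop.prime_dvd_coeff_mulDefectInt_iff_of_hasseCoeff_eq_zero` (top part ⟺ `p ∤ [X^{p−1}] g_W`).
[cite: Fontaine1982FormesDifferentielles, §5] [cite: Colmez1992PeriodesAbeliennes, §2] [cite: Katz1981CrystallineDieudonne, §5.1] -/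
theorem isDeRham_rationalTateRep_curveF_of_supersingular (W : WeierstrassCurve ℤ) [(AinfTop.curveF F W).IsElliptic]
    (hp5 : 5 ≤ p) (hΔ : ¬ (p : ℤ) ∣ W.Δ) (hA : (W.map (Int.castRingHom (ZMod p))).hasseCoeff p = 0)
    (hB : ¬ (p : ℤ) ∣ PowerSeries.coeff (p - 1) W.formalQuasiPeriodIntegrand) :
    GaloisRep.IsDeRham (bdRPeriodRingData (F := F) (p := p) hp) (rationalTateRep (AinfTop.curveF F W) p) :=
  isDeRham_rationalTateRep_curveF_of_etaHasse hp W hp5 hΔ hA (fun _ hj => AinfTop.prime_dvd_coeff_mulDefectInt_of_lt W p hj)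
    fun h => hB ((AinfTop.prime_dvd_coeff_mulDefectInt_iff_of_hasseCoeff_eq_zero W p (by omega) hA).1 h)

/-- **The same in the currency of `isDeRham_restrictedRationalTateRep`**: a curve `W₀` over a subfield `K₀ ⊆ F` whose base change to
`F` is `W ×_ℤ F` (e.g. `K₀ = ℚ`), `W/ℤ` with good supersingular reduction at `p ≥ 5` and `B_p(W) ≢ 0`. BSD is not proved by this.
[cite: Fontaine1982FormesDifferentielles, §5] [cite: Colmez1992PeriodesAbeliennes, §2] -/
theorem isDeRham_restrictedRationalTateRep_of_supersingular {K₀ : Type} [Field K₀] [CharZero K₀] [Algebra K₀ F]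
    (W₀ : WeierstrassCurve K₀) [W₀.IsElliptic] (W : WeierstrassCurve ℤ) (hW : W₀.baseChange F = AinfTop.curveF F W)
    (hp5 : 5 ≤ p) (hΔ : ¬ (p : ℤ) ∣ W.Δ) (hA : (W.map (Int.castRingHom (ZMod p))).hasseCoeff p = 0)
    (hB : ¬ (p : ℤ) ∣ PowerSeries.coeff (p - 1) W.formalQuasiPeriodIntegrand) :
    GaloisRep.IsDeRham (bdRPeriodRingData (F := F) (p := p) hp) (restrictedRationalTateRep W₀ F p) :=
  isDeRham_restrictedRationalTateRep_of_etaHasse hp W₀ W hW hp5 hΔ hA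
    (fun _ hj => AinfTop.prime_dvd_coeff_mulDefectInt_of_lt W p hj)
    fun h => hB ((AinfTop.prime_dvd_coeff_mulDefectInt_iff_of_hasseCoeff_eq_zero W p (by omega) hA).1 h)

end Literature.NumberTheory.PAdicHodge

end
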